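import Literature.NumberTheory.LFunctions.BurnolSonineMultisetNonCompleteProofs
import HarnessLib

/-!
# Burnol 2004, §7: Theorems 7.1–7.3 — the closing file (reductions to Lemma 7.4; the two printed
# examples "accumulation point ⇒ `a₁ = a₂ = 0`" and "finite ⇒ `a₁ = a₂ = +∞`" as theorems)

LINE 1 — LABEL: RH-FREE (order and Hilbert-space bookkeeping on the indices `a₁(𝒵)`, `a₂(𝒵)` of an
ARBITRARY multiset `𝒵 ⊂ ℂ` in de Branges' Sonine chain `K_a`; the Riemann zeta function does not occur).
FRAMING (cell rh-crit, D-0074): corpus theorems are RH-FREE literature; nothing here is worded as progress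
toward RH. bears_on: B-C/B-P (LADDER-RH COLUMN 6, de Branges framework) as corpus literature. WHAT THIS IS
NOT: not a route, not a criterion, no positivity; nothing here bears on the truth of RH.

Source: J.-F. Burnol, *Two complete and minimal systems associated with the zeros of the Riemann zeta
function*, J. Théor. Nombres Bordeaux **16** (2004) 65–94 = arXiv:math/0203120v7 [Burnol2004b], §7
(TeX of record `dbl/src/Burnol2004JTNB_arXivmath0203120v7.tex`, l.1382–1522).

This module sits ABOVE the three §7 proof files of the cell — `BurnolSonineIndexTheoremsProofs.lean`
(the doors `Burnol2004b_thm7_1_of` / `thm7_2_of` / `thm7_3_of(_lemmas)`, the index bookkeeping, the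
monotonicity in `a`, the linear independence of the evaluators), `BurnolSonineMultisetMinimalityProofs.lean`
(dbl-t12: evaluator existence `SonineMultiset.isSonineZ_sonineZ`, Lemma 7.4 reduced to Prop. 4.3) and
`BurnolSonineMultisetNonCompleteProofs.lean` (dbl-t10: `Burnol2004b_lemma7_5_holds`,
`Burnol2004b_lemma7_6_holds`) — and is the place where the hypothesis-free `Burnol2004b_thm7_1/7_2/7_3_holds`
are recorded once `Burnol2004b_lemma7_4_holds` (Prop. 4.3 on the critical line, cell row R19c) lands.

## What is PROVED (theorem-only module: no definition, no named fact)

* §J — the first printed example (TeX l.1398–1402: "Let us take for example the multiset `𝒵` to have an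
  accumulation point `w` (there is for each `ε > 0` at least one complex number `z` in the support of `𝒵`
  with `0 < |z − w| < ε`): then the system is never minimal and is always complete so that `a₁ = 0` and
  `a₂ = 0`"): `BurnolSonineIndex.frequently_of_accumulation` (the printed `ε`-condition ⇒ the filter
  form `∃ᶠ z in 𝓝[≠] w, z ∈ supp 𝒵`), `eq_zero_of_inner_sonineZ_eq_zero_of_frequently` (a `g ∈ K_a`
  orthogonal to the evaluators `Z^a_{z,0}` along such a set is `0`: `⟪Z^a_{z,0}, g⟫ = conj(2𝒢_{ḡ}(z))`,
  identity theorem for the entire `𝒢_{ḡ}`, Mellin injectivity `SonineMultiset.eq_zero_of_completedMellinEntire_eq_zero`),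
  `isCompleteSystemIn_sonineZSystem_of_frequently` (always complete),
  `not_isMinimalSystem_sonineZSystem_of_frequently` (never minimal: the others are still complete),
  `sonineCompleteIndex_eq_zero_of_frequently`, `sonineMinimalIndex_eq_zero_of_frequently`, and
  **Theorem 7.1 in this case unconditionally** (`sonineMinimalIndex_eq_sonineCompleteIndex_of_frequently`).
  (The second printed example, finite multisets, `a₁ = a₂ = +∞`, is
  `BurnolSonineIndex.sonineMinimalIndex_eq_sonineCompleteIndex_of_finite` of the Proofs file.)
* §K — **Theorems 7.1, 7.2, 7.3 reduced to Lemma 7.4 alone**: `Burnol2004b_thm7_1_of_lemma7_4`,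
  `Burnol2004b_thm7_2_of_lemma7_4`, `Burnol2004b_thm7_3_of_lemma7_4` (the doors fed with dbl-t10's
  `Burnol2004b_lemma7_5_holds` / `Burnol2004b_lemma7_6_holds`); the `_holds` are one application away
  from `Burnol2004b_lemma7_4_holds`.

## References
* [Burnol2004b] J.-F. Burnol, JTNB 16 (2004) 65–94 = arXiv:math/0203120v7, §7: the indices and the two
  examples (TeX l.1389–1407), Thms. 7.1–7.3 (TeX l.1409–1428), Lemmas 7.4–7.6 and the assembly sentences
  (TeX l.1435–1522), Thm. 2.1 (TeX l.437–443).
-/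

noncomputable section

open MeasureTheory Complex Filter Set
open scoped Topology ENNReal ComplexConjugate InnerProductSpace

namespace Literature.NumberTheory.LFunctions

namespace BurnolSonineIndex

open BurnolEvaluators

/-! ## J. Multisets with an accumulation point: "never minimal and always complete, `a₁ = a₂ = 0`" -/

section Accumulation

/-- The printed accumulation condition ("there is for each `ε > 0` at least one complex number `z` in the
support of `𝒵` with `0 < |z − w| < ε`") in filter form: the support of `𝒵` is frequented by the
punctured neighbourhoods of `w`. [cite: Burnol2004b, §7 (arXiv:math/0203120v7 p. 17, TeX l.1398–1402)] -/
theorem frequently_of_accumulation {Z : ℂ → ℕ} {w : ℂ}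
    (h : ∀ ε : ℝ, 0 < ε → ∃ z : ℂ, Z z ≠ 0 ∧ 0 < ‖z - w‖ ∧ ‖z - w‖ < ε) :
    ∃ᶠ z in 𝓝[≠] w, Z z ≠ 0 := by
  rw [Filter.frequently_iff]
  intro U hU
  rw [mem_nhdsWithin] at hU
  obtain ⟨V, hVo, hwV, hVU⟩ := hU
  obtain ⟨ε, hε, hball⟩ := Metric.isOpen_iff.1 hVo w hwV
  obtain ⟨z, hz, hz0, hzε⟩ := h ε hε
  refine ⟨z, hVU ⟨hball (by rwa [Metric.mem_ball, dist_eq_norm]), ?_⟩, hz⟩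
  exact fun hzw ↦ hz0.ne' (by rw [mem_singleton_iff.1 hzw, sub_self, norm_zero])

/-- **An evaluator-orthogonal vector vanishes along the set**: if `g ∈ K_a` is orthogonal to the level-`0`
evaluators `Z^a_{z,0}` at the points of a set `S` frequented by the punctured neighbourhoods of some `w`,
then `g = 0` — `⟪Z^a_{z,0}, g⟫ = conj(2·𝒢_{ḡ}(z))`, so the ENTIRE `𝒢_{ḡ}` vanishes on `S`, hence
identically (identity theorem), hence `ḡ = 0` (Mellin–Plancherel injectivity on `K_a`,
`SonineMultiset.eq_zero_of_completedMellinEntire_eq_zero`). [cite: Burnol2004b, §7 (arXiv:math/0203120v7 p. 17, TeX l.1398–1402); Thm. 2.1 (p. 5, TeX l.437–443)] -/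
theorem eq_zero_of_inner_sonineZ_eq_zero_of_frequently {a : ℝ} (ha : 0 < a)
    {g : Lp ℂ 2 (volume : Measure ℝ)} (hg : g ∈ sonineK a) {S : Set ℂ} {w : ℂ}
    (hS : ∃ᶠ z in 𝓝[≠] w, z ∈ S) (h0 : ∀ z ∈ S, ⟪sonineZ a z 0, g⟫_ℂ = 0) : g = 0 := by
  obtain ⟨v, hv⟩ := exists_conj g
  have hvK : v ∈ sonineK a := mem_sonineK_of_conj hg hv
  -- `⟪g, Z⟫ = 2 ∫₀^∞ v·Z = 2 𝒢_v(z)` for the evaluator `Z = Z^a_{z,0}`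
  have key : ∀ z : ℂ, ⟪g, sonineZ a z 0⟫_ℂ = 2 * completedMellinEntire (v : ℝ → ℂ) z := by
    intro z
    have hZ := SonineMultiset.isSonineZ_sonineZ ha z 0
    rw [inner_eq_setIntegral_Ioi hg.1 hZ.1.1 hv]
    calc ∫ t in Ioi (0 : ℝ), (sonineZ a z 0 : ℝ → ℂ) t *
          (((2 : ℂ) • v : Lp ℂ 2 (volume : Measure ℝ)) : ℝ → ℂ) t
        = ∫ t in Ioi (0 : ℝ), (2 : ℂ) * ((v : ℝ → ℂ) t * (sonineZ a z 0 : ℝ → ℂ) t) := by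
          refine integral_congr_ae ((ae_restrict_of_ae (Lp.coeFn_smul (2 : ℂ) v)).mono fun t ht ↦ ?_)
          simp only [ht, Pi.smul_apply, smul_eq_mul]
          ring
      _ = 2 * ∫ t in Ioi (0 : ℝ), (v : ℝ → ℂ) t * (sonineZ a z 0 : ℝ → ℂ) t := integral_const_mul _ _
      _ = 2 * completedMellinEntire (v : ℝ → ℂ) z := by rw [hZ.2 v hvK, iteratedDeriv_zero]
  have hzero : ∀ z ∈ S, completedMellinEntire (v : ℝ → ℂ) z = 0 := by
    intro z hz
    have h := h0 z hz
    rw [← inner_conj_symm, key z, map_mul, mul_eq_zero] at h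
    rcases h with h | h
    · norm_num at h
    · simpa using h
  -- identity theorem: `𝒢_v ≡ 0`
  have hentire : AnalyticOnNhd ℂ (completedMellinEntire (v : ℝ → ℂ)) univ :=
    (hasCompletedMellinEntire_of_mem_sonineK ha hvK).1.differentiableOn.analyticOnNhd isOpen_univ
  have hfreq : ∃ᶠ z in 𝓝[≠] w, completedMellinEntire (v : ℝ → ℂ) z = (fun _ ↦ (0 : ℂ)) z :=
    hS.mono fun z hz ↦ hzero z hz
  have hG : completedMellinEntire (v : ℝ → ℂ) = fun _ ↦ (0 : ℂ) :=
    hentire.eq_of_frequently_eq analyticOnNhd_const hfreq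
  have hv0 : v = 0 :=
    SonineMultiset.eq_zero_of_completedMellinEntire_eq_zero ha hvK fun s ↦ by rw [hG]
  -- `g = conj v = 0`
  apply Lp.ext
  have hv' : (v : ℝ → ℂ) =ᵐ[volume] 0 := by rw [hv0]; exact Lp.coeFn_zero ℂ 2 volume
  filter_upwards [hv, hv', Lp.coeFn_zero ℂ 2 (volume : Measure ℝ)] with t ht ht' h0
  rw [h0, Pi.zero_apply]
  have : conj ((g : ℝ → ℂ) t) = 0 := by rw [← ht, ht', Pi.zero_apply]
  simpa using this

/-- **"take the multiset `𝒵` to have an accumulation point `w` … then the system is … always complete"**: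
in every `K_a` the evaluator system of `𝒵` is complete. [cite: Burnol2004b, §7 (arXiv:math/0203120v7 p. 17, TeX l.1398–1402)] -/
theorem isCompleteSystemIn_sonineZSystem_of_frequently {Z : ℂ → ℕ} {w : ℂ}
    (hacc : ∃ᶠ z in 𝓝[≠] w, Z z ≠ 0) {a : ℝ} (ha : 0 < a) :
    IsCompleteSystemIn (sonineK a) (sonineZSystem a Z) := by
  have hu : ∀ p : MultisetIndex Z,
      sonineZSystem a Z p ∈ Literature.NumberTheory.ConnesConsani2021.soninSpace a a := by
    intro p
    rw [← SetLike.mem_coe, ← sonineK_eq_soninSpace]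
    exact SonineMultiset.sonineZSystem_mem_sonineK ha Z p
  rw [sonineK_eq_soninSpace]
  refine isCompleteSystemIn_of_forall_inner_eq_zero
    (Literature.NumberTheory.ConnesConsani2021.soninSpace a a)
    (Literature.NumberTheory.ConnesConsani2021.isClosed_soninSpace a a) hu fun g hg h0 ↦ ?_
  have hg' : g ∈ sonineK a := by
    rw [sonineK_eq_soninSpace, SetLike.mem_coe]
    exact hg
  refine eq_zero_of_inner_sonineZ_eq_zero_of_frequently ha hg' (S := Function.support Z) hacc
    fun z hz ↦ ?_
  exact h0 ⟨(z, 0), Nat.pos_of_ne_zero hz⟩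

/-- **"… never minimal"**: with an accumulation point, every evaluator of the system lies in the closed
span of the others (the others are still complete, the punctured support still accumulating at `w`).
[cite: Burnol2004b, §7 (arXiv:math/0203120v7 p. 17, TeX l.1398–1402)] -/
theorem not_isMinimalSystem_sonineZSystem_of_frequently {Z : ℂ → ℕ} {w : ℂ}
    (hacc : ∃ᶠ z in 𝓝[≠] w, Z z ≠ 0) {a : ℝ} (ha : 0 < a) :
    ¬ IsMinimalSystem (sonineZSystem a Z) := by
  -- an index exists
  obtain ⟨z₀, hz₀⟩ := hacc.exists
  set i : MultisetIndex Z := ⟨(z₀, 0), Nat.pos_of_ne_zero hz₀⟩ with hi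
  intro hmin
  apply hmin i
  -- the others are complete in `K_a`: any `g ∈ K_a` orthogonal to them vanishes
  set V := Literature.NumberTheory.ConnesConsani2021.soninSpace a a with hV
  have hmem : ∀ p : MultisetIndex Z, sonineZSystem a Z p ∈ sonineK a :=
    fun p ↦ SonineMultiset.sonineZSystem_mem_sonineK ha Z p
  have hothers : IsCompleteSystemIn (V : Set (Lp ℂ 2 (volume : Measure ℝ)))
      (fun j : {j : MultisetIndex Z // j ≠ i} ↦ sonineZSystem a Z j.1) := by
    refine isCompleteSystemIn_of_forall_inner_eq_zero V
      (Literature.NumberTheory.ConnesConsani2021.isClosed_soninSpace a a)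
      (fun j ↦ by rw [hV, ← SetLike.mem_coe, ← sonineK_eq_soninSpace]; exact hmem j.1)
      fun g hg h0 ↦ ?_
    have hg' : g ∈ sonineK a := by
      rw [sonineK_eq_soninSpace, SetLike.mem_coe]
      exact hg
    -- the punctured support still accumulates at `w`
    have hacc' : ∃ᶠ z in 𝓝[≠] w, z ∈ {z : ℂ | Z z ≠ 0 ∧ z ≠ z₀} := by
      by_cases hw : z₀ = w
      · refine hacc.mp (eventually_nhdsWithin_of_forall fun z hz hZz ↦ ⟨hZz, ?_⟩)
        rw [hw]; exact hz
      · have hev : ∀ᶠ z in 𝓝[≠] w, z ≠ z₀ :=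
          eventually_nhdsWithin_of_eventually_nhds (isOpen_ne.eventually_mem (Ne.symm hw))
        exact (hacc.and_eventually hev).mono fun z hz ↦ hz
    refine eq_zero_of_inner_sonineZ_eq_zero_of_frequently ha hg' hacc' fun z hz ↦ ?_
    have hj : (⟨(z, 0), Nat.pos_of_ne_zero hz.1⟩ : MultisetIndex Z) ≠ i := by
      intro h
      have := congrArg (fun q : MultisetIndex Z ↦ q.1.1) h
      exact hz.2 this
    exact h0 ⟨_, hj⟩
  have hsub : sonineK a ⊆ closure (Submodule.span ℂ
      (Set.range fun j : {j : MultisetIndex Z // j ≠ i} ↦ sonineZSystem a Z j.1) :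
        Set (Lp ℂ 2 (volume : Measure ℝ))) := by
    rw [sonineK_eq_soninSpace]
    exact hothers.2
  have hrange : Set.range (fun j : {j : MultisetIndex Z // j ≠ i} ↦ sonineZSystem a Z j.1) =
      sonineZSystem a Z '' {j | j ≠ i} := by
    ext x
    constructor
    · rintro ⟨j, rfl⟩
      exact ⟨j.1, j.2, rfl⟩
    · rintro ⟨j, hj, rfl⟩
      exact ⟨⟨j, hj⟩, rfl⟩
  rw [hrange] at hsub
  exact hsub (hmem i)

/-- "`a₂ = 0`": with an accumulation point the completeness index vanishes.
[cite: Burnol2004b, §7 (arXiv:math/0203120v7 p. 17, TeX l.1398–1402)] -/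
theorem sonineCompleteIndex_eq_zero_of_frequently {Z : ℂ → ℕ} {w : ℂ}
    (hacc : ∃ᶠ z in 𝓝[≠] w, Z z ≠ 0) : sonineCompleteIndex Z = 0 := by
  refine le_antisymm (ENNReal.le_of_forall_pos_le_add fun ε hε _ ↦ ?_) bot_le
  rw [zero_add, ← ENNReal.ofReal_coe_nnreal]
  have hε' : 0 < (ε : ℝ) := by exact_mod_cast hε
  exact sonineCompleteIndex_le_ofReal hε' (isCompleteSystemIn_sonineZSystem_of_frequently hacc hε')

/-- "`a₁ = 0`": with an accumulation point the minimality index vanishes.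
[cite: Burnol2004b, §7 (arXiv:math/0203120v7 p. 17, TeX l.1398–1402)] -/
theorem sonineMinimalIndex_eq_zero_of_frequently {Z : ℂ → ℕ} {w : ℂ}
    (hacc : ∃ᶠ z in 𝓝[≠] w, Z z ≠ 0) : sonineMinimalIndex Z = 0 := by
  refine le_antisymm (sSup_le ?_) bot_le
  rintro x ⟨a, ha, -, hmin⟩
  exact absurd hmin (not_isMinimalSystem_sonineZSystem_of_frequently hacc ha)

/-- **Theorem 7.1 for multisets with an accumulation point, unconditionally** ("`a₁ = 0` and `a₂ = 0`").
[cite: Burnol2004b, Thm. 7.1 and §7 (arXiv:math/0203120v7 p. 17, TeX l.1398–1411)] -/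
theorem sonineMinimalIndex_eq_sonineCompleteIndex_of_frequently {Z : ℂ → ℕ} {w : ℂ}
    (hacc : ∃ᶠ z in 𝓝[≠] w, Z z ≠ 0) : sonineMinimalIndex Z = sonineCompleteIndex Z := by
  rw [sonineMinimalIndex_eq_zero_of_frequently hacc, sonineCompleteIndex_eq_zero_of_frequently hacc]

end Accumulation

end BurnolSonineIndex

/-! ## K. Theorems 7.1, 7.2, 7.3 reduced to Lemma 7.4 (Lemmas 7.5, 7.6 are tree theorems, dbl-t10) -/

/-- **Theorem 7.1 is Lemma 7.4 away**: `a₁(𝒵) = a₂(𝒵)` from Lemma 7.4, Lemma 7.5 being the tree theorem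
`Burnol2004b_lemma7_5_holds`. [cite: Burnol2004b, Thm. 7.1 (arXiv:math/0203120v7 p. 17, TeX l.1409–1411, 1493–1496)] -/
theorem Burnol2004b_thm7_1_of_lemma7_4 (h74 : Burnol2004b_lemma7_4) : Burnol2004b_thm7_1 :=
  Burnol2004b_thm7_1_of h74 Burnol2004b_lemma7_5_holds

/-- **Theorem 7.2 is Lemma 7.4 away** (Lemma 7.6 being the tree theorem `Burnol2004b_lemma7_6_holds`).
[cite: Burnol2004b, Thm. 7.2 (arXiv:math/0203120v7 p. 18, TeX l.1418–1422, 1512–1513)] -/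
theorem Burnol2004b_thm7_2_of_lemma7_4 (h74 : Burnol2004b_lemma7_4) : Burnol2004b_thm7_2 :=
  Burnol2004b_thm7_2_of h74 Burnol2004b_lemma7_6_holds

/-- **Theorem 7.3 is Lemma 7.4 away** (Lemma 7.6 being the tree theorem `Burnol2004b_lemma7_6_holds`,
evaluator existence the tree theorem `SonineMultiset.isSonineZ_sonineZ`).
[cite: Burnol2004b, Thm. 7.3 (arXiv:math/0203120v7 p. 18, TeX l.1424–1428, 1513–1522)] -/
theorem Burnol2004b_thm7_3_of_lemma7_4 (h74 : Burnol2004b_lemma7_4) : Burnol2004b_thm7_3 :=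
  Burnol2004b_thm7_3_of_lemmas h74 Burnol2004b_lemma7_6_holds

end Literature.NumberTheory.LFunctions
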